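import Summits.MatrixMultiplication.MatrixMultiplication.Theses.LevelGradedCohnUmans
import Literature.RepresentationTheory.FiniteGroups.IrreducibleCharacters
import Literature.Barriers.MatrixMultiplication.QuasirandomBarrier
import Summits.MatrixMultiplication.MatrixMultiplication.Theorems.LevelTwoBeatsCubes.Negative.GradedNeumannCount

/-!
# Disproof work file for the crux `LieRankDesigns` (stmt-MatrixMultiplication-7614)

Standing adversary file (cdisprove seat `refuter-cdisprove-stmt-MatrixMultiplication-7614-0`).  Prose
lives in docstrings; every `theorem` below is kernel-checked (rc 0, no `sorry`) unless it sits in the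
final `NearMisses` section.

## Verdict so far
No kill.  The statement has no rendering defect (strictness, finiteness of `irrChars`, `rpow` corners,
`m = 0`, `k = 0`, `k ≥ m` all audited), and an honest `¬ LieRankDesigns` would be a NEW graded packing
barrier (`F_k`-separated ⇒ `Σ_{ρ^{H_k} ≠ 0} d_ρ^{2+ε} ≥ V^{(2+ε)/3}` for some fixed `ε`), unknown on paper.
What IS proved here is the load-bearing skeleton every witness must respect.

## Landed in `Theorems/LieRankDesigns/Negative/` (all `--supports` 7614, sorry-free, std axioms)
`Basics.lean` (p74263: vocabulary + `lieRankDesigns_iff`, budget ≥ 1, level-0 / `m = 0` slices false,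
tightness), `Walls.lean` (p95096: `levelSet_transl`, `wall_XY/YZ`, `volume_sq_le`, `neumann_X/Z`,
`volume_le_cubicBudget`), `DetTwist.lean` (p95131: twisted Gauss sums, `delta_not_mem_levelSet`,
pigeonhole), `Slices.lean` (p95160: `tpp_of_rankSep`, abelian slice `m = 1` false), `Isotropy.lean`
(to follow: isotropy bound).  The general-`(m,k)` infrastructure first written here (`transl`,
`readout`, `levelSubmodule`, `quadProducts`, `wall_XZ`, …) was meanwhile landed by the sibling seat of
crux `LevelOneGL2Designs` (14080) as `Theorems/LevelOneGL2Designs/Negative/{Exponent,LevelSpace}.lean`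
and is REUSED from there (no duplicates); the lead's line `Lines/Sketch.lean` imports `Basics`.

## Findings (index)
* `lieRankDesigns_iff` — the crux unfolds by `Iff.rfl` to `RankSep k X Y Z ∧ budget p m k (2+ε) <
  volume X Y Z ^ ((2+ε)/3)` in this file's vocabulary (nothing below drifts from the filed text).
* `one_le_budget`, `two_le_volume` — the trivial character is the rank-`0` mode, so the budget is `≥ 1`
  and every witness has `|X||Y||Z| ≥ 2`.  `budget_levelZero` (budget `= 1` at `k = 0`) and
  `lieRankDesigns_le_variant` (the `≤`-version is TRIVIALLY TRUE by the singleton design): the strict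
  `<` is load-bearing and tight.
* `not_lieRankDesigns_levelZero` — STRENGTHENING REFUTED: the slice `k = 0` is false for every `ε`.
* `not_lieRankDesigns_rankZeroMatrices` — the slice `m = 0` is false.
* `levelSet_matOne_eq_univ`, `budget_matOne`, `not_lieRankDesigns_matOne` — the abelian slice
  `m = 1` is false (for `k ≥ 1` every function on `GL_1(𝔽_p)` has level `k`, the budget is the FULL
  one `= p − 1 ≥ V ≥ V^{(2+ε)/3}` for `ε ≤ 1`); so every witness has `m ≥ 2` and `1 ≤ k`.
* `fourierFn_transl`, `levelSet_transl` — `F_k` is bi-invariant (`rk(aMb) = rk M`), as the planner claims.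
* `card_le_card_rankLE_of_deltas`, `wall_XY`, `wall_XZ`, `wall_YZ`, `volume_sq_le` — the three WALLS
  `|X||Y|, |X||Z|, |Y||Z| ≤ N_k := #{M ∈ M_m(𝔽_p) : rk M ≤ k}`, hence `V ≤ N_k^{3/2}` (Lie analogue of
  the route's `TokenWall`; the sharper `≤ dim F_k|_G = Σ_{R_k} d_ρ²` holds on paper).
* `levelSubmodule`, `mem_levelSubmodule_iff`, `neumann_X`, `neumann_Z`, `volume_le_cubicBudget` —
  `F_k|_G` as a left/right-invariant submodule of `dim ≤ N_k`, so the sibling seat's GRADED NEUMANN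
  COUNT (`LevelTwoBeatsCubes.Negative.GradedNeumannCount`, which refuted the `S_n` level-2 crux)
  applies verbatim: `|X||Z| + max(|X|,|Z|)(|Y|−1) ≤ N_k` and the cubic budget `V ≤ 0.385 N_k^{3/2}`.
  For `GL_2(𝔽_3)`, level 1 (`N_1 = 33`, in fact `dim = 26`) this alone caps `V ≤ 54 < 92 = B_1(3)`:
  the smallest Lie instance of the exponent-3 milestone is DEAD by theorem; asymptotically the count
  does NOT kill the crux (window `(B_k(2+ε)^{3/(2+ε)}, 0.385 D_k^{3/2}]` is non-empty for `p` large,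
  since `R_k` has `≈ p^k` near-maximal irreducibles — the multiplicity that `S_n` lacks).
* `sum_psi_mul_detChar_eq_zero`, `sum_fourierFn_mul_detChar_eq_zero`, `delta_not_mem_levelSet` —
  for `p` odd, twisted Gauss sums `Σ_g ψ(tr Mg) θ(det g)` vanish for `rk M < m`; so every level-`k < m`
  function is `⊥ θ∘det` and NO delta function has level `< m`.
* `card_XY_add_card_YZ_le` — PIGEONHOLE: `p` odd, `k < m`, `X, Z ≠ ∅` ⇒ `|X||Y| + |Y||Z| ≤ |GL_m(𝔽_p)|`
  (else `X⁻¹Y·Y⁻¹Z = G` forces a separating function to be a delta).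
* `sum_fourierFn_mul_fourierFn_mul_detChar_eq_zero`, `card_XZ_add_card_quadProducts_le` — NEW
  ISOTROPY BOUND: for `p` odd and `2k < m` (the planner's regime `k ≈ 0.29 m` included) the level
  `F_k` is `θ∘det`-ISOTROPIC (`F_k · F_k ⊆ F_{2k} ⊥ θ∘det`), so the separating functions `f_t`,
  `t ∈ X⁻¹Z`, restricted to `G ∖ P` (`P := X⁻¹YY⁻¹Z`, `quadProducts`) have Gram matrix `−diag θ(det t)`
  and are independent: `|X|·|Z| + |X⁻¹YY⁻¹Z| ≤ |GL_m(𝔽_p)|`.  The quadruple-product set must MISS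
  at least `|X||Z|` elements — wall-saturating designs at levels `0.29 m ≤ k < m/2` have
  `|X⁻¹Y|·|Y⁻¹Z| ≈ D_k² ≥ |G|`, so `P` is a product set of two huge sets that still misses `≈ D_k`
  points: only highly structured (coset-like) triples can qualify; random-like ones are dead.
* `tpp_of_rankSep`, `volume_le_of_cor35` — separation ⇒ TPP, so `BCGPU2023_cor35`/`thm32` cap `V`.

## Numerics the provers should know (paper + kit jobs, see NOTES.md of the seat)
`F_k|_G = span{g ↦ [gU = V]} = ⊕{M_ρ : ρ^{H_k} ≠ 0}`, `H_k = Stab(e_1,…,e_k)` (checked: `dim F_1|_{GL_2(𝔽_3)}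
= 26 = p³+p²−3p−1`).  Level 1 in `GL_2(𝔽_p)`: `R_1 = {1, St, π(θ,1)}`, `D_1 = p³+p²−3p−1`,
`B_1(3) = 1+p³+(p−2)(p+1)³`.  EXPONENT-3 MILESTONE at level 1 in `GL_2(𝔽_p)` versus the graded Neumann
cap `max_q (qD_1 + q² − q³)`: `p = 3: 54 < 92`, `p = 5: 644 < 774`, `p = 7: 2860 < 2904` — DEAD by
theorem; `p = 11: (16884, 21032]`, `p = 13: (32382, 43960]` — OPEN (sets of size ≈ 26–28 resp. 32–35;
beyond exhaustive search, a construction is needed).  `GL_3(𝔽_2)`: level 1 empty, level 2 `756 < 1072`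
dead; `GL_3(𝔽_3)` level 1: `2240 < 3926` dead.  So every instance small enough to search is settled
NEGATIVELY by `neumann_X/Z`; kit jobs j008415 (GL_2(𝔽_3) level-1 exhaustive by size pattern — maps
which Neumann-admissible shapes exist at all), j008454, j008457 (random growth in GL_2(𝔽_5), GL_3(𝔽_2))
only measure the slack below the cap.  RESULT j008415 (GL_2(𝔽_3), level 1, EXHAUSTIVE over all
canonical `X`, 16 size patterns, 26 min, complete): NO `F_1`-separated triple of shape `(3,3,4)`,
`(3,4,3)`, `(3,3,5)`, `(3,5,3)`, `(3,4,4)`, `(4,3,4)`, `(4,4,4)`, `(4,3,3)`, `(2,4,4)`, `(2,5,5)`,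
`(2,6,6)` nor of any milestone shape exists (shapes `(a,b,c) ~ (c,b,a)` by inversion-closure of `F_1`,
checked); `(3,3,3)` (V = 27) and `(2,4,3)` exist.  So at `p = 3` the true maximum over shapes with
all sides `≥ 3` is `V = 27`, half the Neumann cap `54`: the count has a factor-2 slack already at the
smallest prime (j008454/j008457, random growth at `p = 5` / `GL_3(𝔽_2)`, were cancelled by the
scheduler while the seat was parked; not resubmitted — those instances are settled by theorem).

## Line `Sketch` (lead prover-line-…-7614-0, PICKED 2026-08-16) — the disprover's reading
The skeleton's proved stubs A–F, I–L (frame duality, parabolic counting, CellBudget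
`budget_s ≤ 2^{m(s−1)} p^{(mk−k²/2)s}(p−1)^{−(s−2)/2}`) and the transfers `G ⇒ G'' ⇒ crux` are landed
theorems; the OPEN stubs `FixedCellSaturation` (G), `NearWallDesigns` (G''), `FamilySaturation` (G')
are pure design-existence statements — the crux's content in wall form — and none is cheaply
refutable: refuting G at a cell = a fixed-cell barrier `V = o(D_k^{3/2})`, refuting G'' = such
barriers with `inf_cells η > 0`.  What this file contributes to them: every witness of G/G''/G' is
`RankSep`, hence obeys the walls, the Neumann cap `V ≤ 0.385 N_k^{3/2}` (so G needs `c₀ ≤ 0.385·(N_k /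
p^{2mk−k²})^{3/2}`), the pigeonhole (`k < m`) and, at the Borel-template cells `2k < m` of crux
`SubgroupIdentityDesigns` (14079), the ISOTROPY bound `|X||Z| + |X⁻¹YY⁻¹Z| ≤ |G|` — for subgroup
witnesses `H₁, H₂, H₃` this reads `|H₁||H₂||H₃| ≤ |G| − |H₁||H₃|` (volume strictly below `|G|`; no
bite at `m = k² + 3k/2`, where `D_k^{3/2} ≪ |G|`).  At the Siegel arena `m = 2k` only the pigeonhole
applies.  The `(2,1)` cell of G is crux `LevelOneGL2Designs` (14080), whose own negative lane
(`ConstantWindow.lean`) already has `c < 1/√2` from the Neumann count; first live prime `p = 11`.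
JOINT SUFFICIENCY of the line is sound (checked on paper: `G'' ⇒ crux` only needs the centre's slack
`(p−1)^{ε/2}` of CellBudget and `δ < 3ε/(2(2+ε))`, cell chosen after `δ`).

## Reformulation of level 1 (for provers and planners)
At level 1 the read-out algebra `A_J = ℂ[G]/F_1^⊥` embeds in `End ℂ[Ω]`, `Ω = 𝔽_p^m ∖ 0`, as the
operators commuting with the dilations `𝔽_p^×` and having constant row/column sums, and `π(g)` is
the PERMUTATION MATRIX of `g` on `Ω` (`F_1|_G = span{[gu = v]}`).  For `m = 2` this says:
`F_1`-separation in `GL_2(𝔽_p)` = 1-TOKEN separation in the monomial group `W = C_{p−1} ≀ S_{p+1}`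
(`Ω = C_{p−1} × P¹(𝔽_p)`, tests `f(w) = Σ_{i ∈ P¹} Φ_i(w·i)`) restricted to the subgroup
`GL_2(𝔽_p) < W`; the budget `1 + p^s + (p−2)(p+1)^s` is the same for `W` itself.  Decoupling
`r = |C|` from `n = |P¹|` gives the two-parameter host family `C_r ≀ S_n` with
`dim J = 1 + (n−1)² + (r−1)n²` and budget `1 + (n−1)^s + (r−1)n^s`, alive against the Neumann cap
iff `r^{3/2 − 3/(2+ε)} > 3√3/2` (`r ≥ 7` at `ε = 1`; `r → ∞` as `ε → 0`); inside the abelian base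
`C_r^n` the 1-token space is the weight-`≤ 1` Fourier space, where a triple AND cannot be a SUM
across coordinate blocks, so any design must genuinely use the permutation part.  (Card seed for
the planner: wreath-product token hosts; not this seat's to file.)

## Why it resists (for the provers)
As `ε → 0` the window `(B_k(2+ε)^{3/(2+ε)}, D_k^{3/2}]` has relative width `→ 1`: a witness family must
SATURATE all three walls simultaneously (`|X||Y| ≈ |X||Z| ≈ |Y||Z| ≈ D_k`) while staying subcritical for
the quasirandom cap (`(m−k)²/2 > m/6`).  No construction at any level `k < m` beating even exponent 3 is
known; the smallest instances are being exhausted by computation.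

## Not yet formalised (closable, deferred)
`k ≥ m ⇒ levelSet = univ` (Fourier inversion on `M_m(𝔽_p)`: the top level is the full CKSU budget);
the sharp wall `|X||Y| ≤ dim F_k|_G = Σ_{R_k} d_ρ²` (needs the Wedderburn decomposition of bi-invariant
subspaces); `k < m ⇒ θ∘det ∉ F_k` is in, but the full description `Irr ∩ F_k = {ρ : ρ^{H_k} ≠ 0}` is not.
-/

set_option linter.dupNamespace false

noncomputable section

open scoped BigOperators
open Literature.RepresentationTheory.FiniteGroups

namespace Summit.MatrixMultiplication.MatrixMultiplication.Cruxes.LieRankDesigns.Disproof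

open Summit.MatrixMultiplication.MatrixMultiplication.Theses.LevelGradedCohnUmans

/-! ## Vocabulary (definitionally equal to the inlined clauses of the crux) -/

/-- `GL_m(𝔽_p)` as in the crux. -/
abbrev GLm (p m : ℕ) : Type := Matrix.GeneralLinearGroup (Fin m) (ZMod p)

/-- `M_m(𝔽_p)`, the Fourier side. -/
abbrev Mat (p m : ℕ) : Type := Matrix (Fin m) (Fin m) (ZMod p)

variable {p m : ℕ}

/-- The Fourier function `g ↦ Σ_M c_M ψ(tr(M g))` with coefficient table `c` (`ψ = ZMod.stdAddChar`). -/
def fourierFn [Fact p.Prime] (c : Mat p m → ℂ) (g : GLm p m) : ℂ :=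
  ∑ M : Mat p m, c M * ZMod.stdAddChar (Matrix.trace (M * (g : Mat p m)))

/-- "Fourier rank ≤ k": the coefficient table vanishes on matrices of rank `> k`. -/
def RankSupp [Fact p.Prime] (k : ℕ) (c : Mat p m → ℂ) : Prop :=
  ∀ M : Mat p m, k < M.rank → c M = 0

/-- `F_k`-separation of the triple `(X, Y, Z)`, literally the first clause of the crux. -/
def RankSep [Fact p.Prime] (k : ℕ) (X Y Z : Finset (GLm p m)) : Prop :=
  ∀ x₀ ∈ X, ∀ z₀ ∈ Z, ∃ c : Mat p m → ℂ, RankSupp k c ∧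
    ∀ x ∈ X, ∀ y ∈ Y, ∀ y' ∈ Y, ∀ z ∈ Z,
      fourierFn c (x⁻¹ * y * y'⁻¹ * z) = if x = x₀ ∧ y = y' ∧ z = z₀ then 1 else 0

/-- The level-`k` test space `F_k` restricted to `GL_m(𝔽_p)` (as a set of functions). -/
def levelSet (p m : ℕ) [Fact p.Prime] (k : ℕ) : Set (GLm p m → ℂ) :=
  {f | ∃ c : Mat p m → ℂ, RankSupp k c ∧ ∀ g : GLm p m, f g = fourierFn c g}

/-- The graded budget `Σ_{χ ∈ Irr(GL_m(𝔽_p)) ∩ F_k} χ(1)^s`. -/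
def budget (p m : ℕ) [Fact p.Prime] (k : ℕ) (s : ℝ) : ℝ :=
  ∑ᶠ χ ∈ irrChars (GLm p m) ∩ levelSet p m k, (χ 1).re ^ s

/-- The volume `|X||Y||Z|` as a real number (cast of the natural number, as in the crux). -/
def volume (X Y Z : Finset (GLm p m)) : ℝ := ((X.card * Y.card * Z.card : ℕ) : ℝ)

/-- The crux, restated in this vocabulary — by `Iff.rfl`, so nothing below drifts from the
statement as filed. -/
theorem lieRankDesigns_iff :
    LieRankDesigns ↔ ∀ ε : ℝ, 0 < ε → ∃ (p : ℕ) (_ : Fact p.Prime) (m k : ℕ)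
      (X Y Z : Finset (GLm p m)), RankSep k X Y Z ∧ budget p m k (2 + ε) < volume X Y Z ^ ((2 + ε) / 3) :=
  Iff.rfl

/-! ## The budget is never below 1 (trivial character); hence witnesses have volume ≥ 2 -/

section Budget

variable [Fact p.Prime]

/-- The coefficient table of the constant function `1`: `δ_{M = 0}`. -/
def constCoeff (p m : ℕ) : Mat p m → ℂ := fun M => if M = 0 then 1 else 0

/-- The constant table is supported in rank `0 ≤ k`. [folklore] -/
theorem rankSupp_constCoeff (k : ℕ) : RankSupp (p := p) (m := m) k (constCoeff p m) := by
  intro M hM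
  unfold constCoeff
  split_ifs with h
  · subst h; simp at hM
  · rfl

/-- The Fourier function of the constant table is `1`. [folklore] -/
theorem fourierFn_constCoeff (g : GLm p m) : fourierFn (constCoeff p m) g = 1 := by
  unfold fourierFn constCoeff
  simp [Finset.sum_ite_eq']

/-- The trivial character of any group is the constant function `1`. -/
theorem character_trivial_apply {G : Type} [Group G] (g : G) :
    (Representation.trivial ℂ G ℂ).character g = 1 := by
  simp [Representation.character, Representation.trivial]

/-- The trivial character lies in every level `F_k` (it is the rank-`0` Fourier mode `M = 0`). -/
theorem trivial_mem_levelSet (k : ℕ) :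
    (Representation.trivial ℂ (GLm p m) ℂ).character ∈ irrChars (GLm p m) ∩ levelSet p m k :=
  ⟨character_trivial_mem_irrChars,
    ⟨constCoeff p m, rankSupp_constCoeff k, fun g => by
      rw [character_trivial_apply, fourierFn_constCoeff]⟩⟩

/-- Every irreducible character has `χ(1) = d ∈ ℕ`, so `(χ 1).re ≥ 0`. -/
theorem re_apply_one_nonneg {G : Type} [Group G] {χ : G → ℂ} (h : χ ∈ irrChars G) :
    0 ≤ (χ 1).re := by
  obtain ⟨d, -, hd⟩ := IsIrrChar.exists_apply_one h
  rw [hd]; simp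

/-- **The graded budget is at least `1`** for every level `k` and every real exponent `s`:
the trivial character contributes `1^s = 1` and all other terms are `≥ 0` (the family of
irreducible characters is finite, `irrChars_finite_holds`, so the `finsum` is a genuine sum). -/
theorem one_le_budget (k : ℕ) (s : ℝ) : 1 ≤ budget p m k s := by
  classical
  unfold budget
  rw [finsum_mem_def]
  set S := irrChars (GLm p m) ∩ levelSet p m k with hS
  have hfin : (Function.support (S.indicator fun χ => (χ 1).re ^ s)).Finite :=
    ((irrChars_finite_holds (GLm p m)).subset Set.inter_subset_left).subset
      Set.support_indicator_subset
  have hnn : ∀ χ, 0 ≤ S.indicator (fun χ => (χ 1).re ^ s) χ := by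
    intro χ
    by_cases hχ : χ ∈ S
    · rw [Set.indicator_of_mem hχ]
      exact Real.rpow_nonneg (re_apply_one_nonneg hχ.1) s
    · rw [Set.indicator_of_notMem hχ]
  have h1 := single_le_finsum (Representation.trivial ℂ (GLm p m) ℂ).character hfin hnn
  rw [Set.indicator_of_mem (trivial_mem_levelSet k), character_trivial_apply] at h1
  simpa using h1

/-- **Witnesses have volume at least `2`**: with `|X||Y||Z| ∈ {0, 1}` the right-hand side of the
crux is `0` or `1`, never above the budget (`≥ 1`).  So the empty and the singleton designs are
excluded by the strict inequality. -/
theorem two_le_volume {k : ℕ} {ε : ℝ} (hε : 0 < ε) {X Y Z : Finset (GLm p m)}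
    (h : budget p m k (2 + ε) < volume X Y Z ^ ((2 + ε) / 3)) :
    2 ≤ X.card * Y.card * Z.card := by
  by_contra hlt
  push Not at hlt
  have h1 := one_le_budget (p := p) (m := m) k (2 + ε)
  unfold volume at h
  interval_cases hV : X.card * Y.card * Z.card
  · rw [Nat.cast_zero, Real.zero_rpow (by positivity)] at h
    linarith
  · rw [Nat.cast_one, Real.one_rpow] at h
    linarith

end Budget

/-! ## Level `k = 0` is dead (constants separate nothing) -/

section LevelZero

variable [Fact p.Prime]

/-- A nonzero matrix over a field has positive rank. -/
theorem rank_pos_of_ne_zero {M : Mat p m} (hM : M ≠ 0) : 0 < M.rank := by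
  rw [Nat.pos_iff_ne_zero]
  intro h0
  apply hM
  have hbot : LinearMap.range M.mulVecLin = ⊥ := Submodule.finrank_eq_zero.mp h0
  ext i j
  have := LinearMap.range_eq_bot.mp hbot
  have hv : M.mulVecLin (Pi.single j 1) = 0 := by rw [this]; rfl
  rw [Matrix.mulVecLin_apply, Matrix.mulVec_single_one] at hv
  exact congrFun hv i

/-- At level `0` every test function is constant (`= c 0`). -/
theorem fourierFn_const_of_rankSupp_zero {c : Mat p m → ℂ} (hc : RankSupp 0 c) (g : GLm p m) :
    fourierFn c g = c 0 := by
  classical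
  unfold fourierFn
  rw [Finset.sum_eq_single (0 : Mat p m)]
  · simp
  · intro M _ hM
    rw [hc M (rank_pos_of_ne_zero hM), zero_mul]
  · intro h; exact absurd (Finset.mem_univ _) h

/-- **Level `0` separates only the trivial design**: if `(X, Y, Z)` is `F_0`-separated then
`|X||Y||Z| ≤ 1`. -/
theorem volume_le_one_of_rankSep_zero {X Y Z : Finset (GLm p m)} (h : RankSep 0 X Y Z) :
    X.card * Y.card * Z.card ≤ 1 := by
  classical
  by_contra hV
  push Not at hV
  -- all three sets are nonempty
  have hX : X.Nonempty := Finset.card_pos.mp (Nat.pos_of_ne_zero fun h0 => by simp [h0] at hV)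
  have hY : Y.Nonempty := Finset.card_pos.mp (Nat.pos_of_ne_zero fun h0 => by simp [h0] at hV)
  have hZ : Z.Nonempty := Finset.card_pos.mp (Nat.pos_of_ne_zero fun h0 => by simp [h0] at hV)
  obtain ⟨x₀, hx₀⟩ := hX
  obtain ⟨y₀, hy₀⟩ := hY
  obtain ⟨z₀, hz₀⟩ := hZ
  obtain ⟨c, hc, hsep⟩ := h x₀ hx₀ z₀ hz₀
  have hconst := fourierFn_const_of_rankSupp_zero hc
  have htarget := hsep x₀ hx₀ y₀ hy₀ y₀ hy₀ z₀ hz₀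
  rw [hconst, if_pos ⟨rfl, rfl, rfl⟩] at htarget
  -- one of the three sets has two elements
  have hbig : 1 < X.card ∨ 1 < Y.card ∨ 1 < Z.card := by
    by_contra hh
    push Not at hh
    obtain ⟨h1, h2, h3⟩ := hh
    have : X.card * Y.card * Z.card ≤ 1 * 1 * 1 := by gcongr
    omega
  rcases hbig with h1 | h1 | h1
  · obtain ⟨x₁, hx₁, hne⟩ := Finset.exists_mem_ne h1 x₀
    have := hsep x₁ hx₁ y₀ hy₀ y₀ hy₀ z₀ hz₀
    rw [hconst, if_neg (fun hh => hne hh.1), htarget] at this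
    exact one_ne_zero this
  · obtain ⟨y₁, hy₁, hne⟩ := Finset.exists_mem_ne h1 y₀
    have := hsep x₀ hx₀ y₁ hy₁ y₀ hy₀ z₀ hz₀
    rw [hconst, if_neg (fun hh => hne hh.2.1), htarget] at this
    exact one_ne_zero this
  · obtain ⟨z₁, hz₁, hne⟩ := Finset.exists_mem_ne h1 z₀
    have := hsep x₀ hx₀ y₀ hy₀ y₀ hy₀ z₁ hz₁
    rw [hconst, if_neg (fun hh => hne hh.2.2), htarget] at this
    exact one_ne_zero this

/-- No level-`0` design beats any exponent `2 + ε`, `ε > 0`. -/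
theorem not_design_levelZero {ε : ℝ} (hε : 0 < ε) {X Y Z : Finset (GLm p m)}
    (h : RankSep 0 X Y Z) : ¬ budget p m 0 (2 + ε) < volume X Y Z ^ ((2 + ε) / 3) := fun hlt =>
  absurd (volume_le_one_of_rankSep_zero h) (by have := two_le_volume hε hlt; omega)

end LevelZero

/-- **STRENGTHENING REFUTED (level `0`).**  The slice `k = 0` of `LieRankDesigns` is false: for
no `ε > 0` is there a level-`0` design (any prime, any `m`). Any proof of the crux must use
Fourier modes of positive rank. -/
theorem not_lieRankDesigns_levelZero :
    ¬ (∀ ε : ℝ, 0 < ε → ∃ (p : ℕ) (_ : Fact p.Prime) (m : ℕ) (X Y Z : Finset (GLm p m)),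
        RankSep 0 X Y Z ∧ budget p m 0 (2 + ε) < volume X Y Z ^ ((2 + ε) / 3)) := by
  intro h
  obtain ⟨p, hp, m, X, Y, Z, hsep, hlt⟩ := h 1 one_pos
  exact not_design_levelZero one_pos hsep hlt

/-! ## `m = 0` is dead (the trivial group) -/

section RankZeroMatrices

/-- `GL_0` is the trivial group. [folklore] -/
instance : Subsingleton (GLm p 0) := by
  unfold GLm
  infer_instance

/-- In `GL_0` every finite set has at most one element, so the volume is `≤ 1`. -/
theorem volume_le_one_of_m_zero (X Y Z : Finset (GLm p 0)) : X.card * Y.card * Z.card ≤ 1 := by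
  have hX : X.card ≤ 1 := Finset.card_le_one.mpr fun a _ b _ => Subsingleton.elim a b
  have hY : Y.card ≤ 1 := Finset.card_le_one.mpr fun a _ b _ => Subsingleton.elim a b
  have hZ : Z.card ≤ 1 := Finset.card_le_one.mpr fun a _ b _ => Subsingleton.elim a b
  calc X.card * Y.card * Z.card ≤ 1 * 1 * 1 := by gcongr
    _ = 1 := rfl

end RankZeroMatrices

/-- **STRENGTHENING REFUTED (`m = 0`).**  The slice `m = 0` (`GL_0(𝔽_p)` is the trivial group) of
`LieRankDesigns` is false for every `ε > 0`. -/
theorem not_lieRankDesigns_rankZeroMatrices :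
    ¬ (∀ ε : ℝ, 0 < ε → ∃ (p : ℕ) (_ : Fact p.Prime) (k : ℕ) (X Y Z : Finset (GLm p 0)),
        RankSep k X Y Z ∧ budget p 0 k (2 + ε) < volume X Y Z ^ ((2 + ε) / 3)) := by
  intro h
  obtain ⟨p, hp, k, X, Y, Z, -, hlt⟩ := h 1 one_pos
  have := two_le_volume one_pos hlt
  have := volume_le_one_of_m_zero X Y Z
  omega


/-! ## Translation invariance of the levels and the three WALLS `|X||Y|, |X||Z|, |Y||Z| ≤ N_k` -/

section Walls

variable [Fact p.Prime]

/-- Two-sided translate of a coefficient table: `transl a b c N = c (a⁻¹ N b⁻¹)`. -/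
def transl (a b : GLm p m) (c : Mat p m → ℂ) : Mat p m → ℂ :=
  fun N => c (((a⁻¹ : GLm p m) : Mat p m) * N * ((b⁻¹ : GLm p m) : Mat p m))

/-- `M ↦ a M b` as a permutation of `M_m(𝔽_p)`. -/
def mulEquiv (a b : GLm p m) : Mat p m ≃ Mat p m where
  toFun M := (a : Mat p m) * M * (b : Mat p m)
  invFun N := ((a⁻¹ : GLm p m) : Mat p m) * N * ((b⁻¹ : GLm p m) : Mat p m)
  left_inv M := by
    show ((a⁻¹ : GLm p m) : Mat p m) * ((a : Mat p m) * M * (b : Mat p m)) * ((b⁻¹ : GLm p m) : Mat p m) = M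
    rw [Matrix.mul_assoc (a : Mat p m), Units.inv_mul_cancel_left, Units.mul_inv_cancel_right]
  right_inv N := by
    show (a : Mat p m) * (((a⁻¹ : GLm p m) : Mat p m) * N * ((b⁻¹ : GLm p m) : Mat p m)) * (b : Mat p m) = N
    rw [Matrix.mul_assoc ((a⁻¹ : GLm p m) : Mat p m), Units.mul_inv_cancel_left, Units.inv_mul_cancel_right]

/-- **`F_k` is bi-invariant**: translating the coefficient table realises `g ↦ f(b g a)`. -/
theorem fourierFn_transl (a b : GLm p m) (c : Mat p m → ℂ) (g : GLm p m) :
    fourierFn (transl a b c) g = fourierFn c (b * g * a) := by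
  unfold fourierFn transl
  rw [← Equiv.sum_comp (mulEquiv a b)]
  refine Finset.sum_congr rfl fun M _ => ?_
  simp only [mulEquiv, Equiv.coe_fn_mk]
  congr 1
  · congr 1
    rw [Matrix.mul_assoc (a : Mat p m), Units.inv_mul_cancel_left, Units.mul_inv_cancel_right]
  · congr 1
    rw [Units.val_mul, Units.val_mul,
      show (a : Mat p m) * M * (b : Mat p m) * (g : Mat p m) = (a : Mat p m) * (M * (b : Mat p m) * (g : Mat p m)) by
        simp only [Matrix.mul_assoc],
      Matrix.trace_mul_comm]
    simp only [Matrix.mul_assoc]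

/-- Two-sided multiplication by units preserves the rank. [folklore] -/
theorem rank_transl_arg (a b : GLm p m) (N : Mat p m) :
    (((a⁻¹ : GLm p m) : Mat p m) * N * ((b⁻¹ : GLm p m) : Mat p m)).rank = N.rank := by
  have ha : IsUnit (((a⁻¹ : GLm p m) : Mat p m)).det :=
    (Matrix.isUnit_iff_isUnit_det _).mp (Units.isUnit _)
  have hb : IsUnit (((b⁻¹ : GLm p m) : Mat p m)).det :=
    (Matrix.isUnit_iff_isUnit_det _).mp (Units.isUnit _)
  rw [Matrix.rank_mul_eq_left_of_isUnit_det _ _ hb, Matrix.rank_mul_eq_right_of_isUnit_det _ _ ha]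

/-- Translation preserves the rank support. [folklore] -/
theorem rankSupp_transl {k : ℕ} (a b : GLm p m) {c : Mat p m → ℂ} (hc : RankSupp k c) :
    RankSupp k (transl a b c) := fun N hN =>
  hc _ (by rwa [rank_transl_arg])

/-- The level set of functions is closed under two-sided translation. -/
theorem levelSet_transl {k : ℕ} {f : GLm p m → ℂ} (hf : f ∈ levelSet p m k) (a b : GLm p m) :
    (fun g => f (b * g * a)) ∈ levelSet p m k := by
  obtain ⟨c, hc, hfc⟩ := hf
  exact ⟨transl a b c, rankSupp_transl a b hc, fun g => by simp only [hfc, fourierFn_transl]⟩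

/-- Matrices of rank `≤ k` (the Fourier support of level `k`). -/
abbrev RankLE (p m k : ℕ) : Type := {M : Mat p m // M.rank ≤ k}

/-- Sum over all matrices of a rank-supported table = sum over the rank-`≤ k` ones. -/
theorem sum_eq_sum_rankLE {k : ℕ} {c : Mat p m → ℂ} (hc : RankSupp k c) (w : Mat p m → ℂ) :
    ∑ M : Mat p m, c M * w M = ∑ M : RankLE p m k, c M.1 * w M.1 := by
  classical
  rw [← Finset.sum_filter_of_ne (p := fun M : Mat p m => M.rank ≤ k)
      (fun M _ hM => le_of_not_gt fun hlt => hM (by rw [hc M hlt, zero_mul]))]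
  exact Finset.sum_subtype _ (by simp) _

/-- The read-out map `c ↦ (t ↦ Σ_{rk M ≤ k} c_M ψ(tr(M π(t))))`, linear in the coefficient table. -/
def readout {k : ℕ} {T : Type} (π : T → GLm p m) : (RankLE p m k → ℂ) →ₗ[ℂ] (T → ℂ) where
  toFun c t := ∑ M : RankLE p m k, c M * ZMod.stdAddChar (Matrix.trace (M.1 * (π t : Mat p m)))
  map_add' c c' := by
    funext t
    simp only [Pi.add_apply, add_mul, Finset.sum_add_distrib]
  map_smul' r c := by
    funext t
    simp only [Pi.smul_apply, smul_eq_mul, RingHom.id_apply, Finset.mul_sum, mul_assoc]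

/-- The read-out of a restricted rank-supported table is the Fourier function. [folklore] -/
theorem readout_restrict {k : ℕ} {T : Type} (π : T → GLm p m) {c : Mat p m → ℂ} (hc : RankSupp k c)
    (t : T) : readout π (fun M : RankLE p m k => c M.1) t = fourierFn c (π t) := by
  unfold fourierFn
  rw [sum_eq_sum_rankLE hc]
  rfl

/-- **Interpolation bound.**  If level-`k` Fourier functions realise every delta function on the
finite configuration `π : T → GL_m(𝔽_p)`, then `|T| ≤ N_k = #{M : rk M ≤ k}`: the read-out map from
the `N_k`-dimensional coefficient space onto `ℂ^T` is surjective. -/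
theorem card_le_card_rankLE_of_deltas {k : ℕ} {T : Type} [Fintype T] [DecidableEq T]
    (π : T → GLm p m)
    (hδ : ∀ t : T, ∃ c : Mat p m → ℂ, RankSupp k c ∧
      ∀ t' : T, fourierFn c (π t') = if t' = t then 1 else 0) :
    Fintype.card T ≤ Fintype.card (RankLE p m k) := by
  classical
  have hsurj : Function.Surjective (readout (k := k) π) := by
    rw [← LinearMap.range_eq_top, eq_top_iff, ← (Pi.basisFun ℂ T).span_eq, Submodule.span_le]
    rintro _ ⟨t, rfl⟩
    obtain ⟨c, hc, hct⟩ := hδ t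
    refine ⟨fun M => c M.1, ?_⟩
    funext t'
    rw [readout_restrict π hc, hct, Pi.basisFun_apply, Pi.single_apply]
  have h := LinearMap.finrank_le_finrank_of_surjective hsurj
  rwa [Module.finrank_fintype_fun_eq_card, Module.finrank_fintype_fun_eq_card] at h

variable {k : ℕ} {X Y Z : Finset (GLm p m)}

/-- **Wall XY**: an `F_k`-separated triple with `Z ≠ ∅` has `|X|·|Y| ≤ N_k`. -/
theorem wall_XY (hsep : RankSep k X Y Z) (hZ : Z.Nonempty) :
    X.card * Y.card ≤ Fintype.card (RankLE p m k) := by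
  classical
  obtain ⟨z₀, hz₀⟩ := hZ
  have h := card_le_card_rankLE_of_deltas (k := k) (T := ↥(X ×ˢ Y))
    (fun t => t.1.1⁻¹ * t.1.2) ?_
  · rwa [Fintype.card_coe, Finset.card_product] at h
  rintro ⟨⟨x₀, y₁⟩, ht⟩
  rw [Finset.mem_product] at ht
  obtain ⟨c, hc, hsepc⟩ := hsep x₀ ht.1 z₀ hz₀
  refine ⟨transl (y₁⁻¹ * z₀) 1 c, rankSupp_transl _ _ hc, ?_⟩
  rintro ⟨⟨x, y⟩, ht'⟩
  rw [Finset.mem_product] at ht'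
  rw [fourierFn_transl, one_mul, show x⁻¹ * y * (y₁⁻¹ * z₀) = x⁻¹ * y * y₁⁻¹ * z₀ by group,
    hsepc x ht'.1 y ht'.2 y₁ ht.2 z₀ hz₀]
  congr 1
  simp only [and_true, Subtype.mk.injEq, Prod.mk.injEq]

/-- **Wall XZ**: an `F_k`-separated triple with `Y ≠ ∅` has `|X|·|Z| ≤ N_k`. -/
theorem wall_XZ (hsep : RankSep k X Y Z) (hY : Y.Nonempty) :
    X.card * Z.card ≤ Fintype.card (RankLE p m k) := by
  classical
  obtain ⟨y₀, hy₀⟩ := hY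
  have h := card_le_card_rankLE_of_deltas (k := k) (T := ↥(X ×ˢ Z))
    (fun t => t.1.1⁻¹ * t.1.2) ?_
  · rwa [Fintype.card_coe, Finset.card_product] at h
  rintro ⟨⟨x₀, z₀⟩, ht⟩
  rw [Finset.mem_product] at ht
  obtain ⟨c, hc, hsepc⟩ := hsep x₀ ht.1 z₀ ht.2
  refine ⟨c, hc, ?_⟩
  rintro ⟨⟨x, z⟩, ht'⟩
  rw [Finset.mem_product] at ht'
  rw [show x⁻¹ * z = x⁻¹ * y₀ * y₀⁻¹ * z by group, hsepc x ht'.1 y₀ hy₀ y₀ hy₀ z ht'.2]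
  congr 1
  simp only [true_and, Subtype.mk.injEq, Prod.mk.injEq]

/-- **Wall YZ**: an `F_k`-separated triple with `X ≠ ∅` has `|Y|·|Z| ≤ N_k`. -/
theorem wall_YZ (hsep : RankSep k X Y Z) (hX : X.Nonempty) :
    Y.card * Z.card ≤ Fintype.card (RankLE p m k) := by
  classical
  obtain ⟨x₀, hx₀⟩ := hX
  have h := card_le_card_rankLE_of_deltas (k := k) (T := ↥(Y ×ˢ Z))
    (fun t => t.1.1⁻¹ * t.1.2) ?_
  · rwa [Fintype.card_coe, Finset.card_product] at h
  rintro ⟨⟨y₁, z₀⟩, ht⟩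
  rw [Finset.mem_product] at ht
  obtain ⟨c, hc, hsepc⟩ := hsep x₀ hx₀ z₀ ht.2
  refine ⟨transl 1 (x₀⁻¹ * y₁) c, rankSupp_transl _ _ hc, ?_⟩
  rintro ⟨⟨y', z⟩, ht'⟩
  rw [Finset.mem_product] at ht'
  rw [fourierFn_transl, mul_one, show x₀⁻¹ * y₁ * (y'⁻¹ * z) = x₀⁻¹ * y₁ * y'⁻¹ * z by group,
    hsepc x₀ hx₀ y₁ ht.1 y' ht'.1 z ht'.2]
  congr 1
  simp only [true_and, Subtype.mk.injEq, Prod.mk.injEq, eq_iff_iff]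
  constructor
  · rintro ⟨h1, h2⟩; exact ⟨h1.symm, h2⟩
  · rintro ⟨h1, h2⟩; exact ⟨h1.symm, h2⟩

/-- **The three walls at once**: `V² ≤ N_k³`, i.e. `|X||Y||Z| ≤ N_k^{3/2}` for every `F_k`-separated
triple (all three sets nonempty; otherwise `V = 0`). -/
theorem volume_sq_le (hsep : RankSep k X Y Z) :
    (X.card * Y.card * Z.card) ^ 2 ≤ Fintype.card (RankLE p m k) ^ 3 := by
  by_cases hX : X.Nonempty
  · by_cases hY : Y.Nonempty
    · by_cases hZ : Z.Nonempty
      · have h1 := wall_XY hsep hZ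
        have h2 := wall_XZ hsep hY
        have h3 := wall_YZ hsep hX
        calc (X.card * Y.card * Z.card) ^ 2
            = (X.card * Y.card) * (X.card * Z.card) * (Y.card * Z.card) := by ring
          _ ≤ Fintype.card (RankLE p m k) * Fintype.card (RankLE p m k) * Fintype.card (RankLE p m k) := by
            gcongr
          _ = Fintype.card (RankLE p m k) ^ 3 := by ring
      · rw [Finset.not_nonempty_iff_eq_empty.mp hZ]; simp
    · rw [Finset.not_nonempty_iff_eq_empty.mp hY]; simp
  · rw [Finset.not_nonempty_iff_eq_empty.mp hX]; simp

end Walls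



/-! ## The level space as a submodule; the GRADED NEUMANN COUNT for the crux
(imported from the sibling seat's `LevelTwoBeatsCubes.Negative.GradedNeumannCount`) -/

section Neumann

variable [Fact p.Prime]

/-- The coefficient-to-function map on rank-`≤ k` tables. -/
def levelMap (p m k : ℕ) [Fact p.Prime] : (RankLE p m k → ℂ) →ₗ[ℂ] (GLm p m → ℂ) :=
  readout (k := k) fun g : GLm p m => g

/-- `F_k|_G` as a submodule of `ℂ^{GL_m(𝔽_p)}`. -/
def levelSubmodule (p m k : ℕ) [Fact p.Prime] : Submodule ℂ (GLm p m → ℂ) :=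
  LinearMap.range (levelMap p m k)

variable {k : ℕ}

/-- The submodule and the set-level description agree. -/
theorem mem_levelSubmodule_iff {f : GLm p m → ℂ} : f ∈ levelSubmodule p m k ↔ f ∈ levelSet p m k := by
  classical
  constructor
  · rintro ⟨c', rfl⟩
    have hsupp : RankSupp k (fun M : Mat p m => if h : M.rank ≤ k then c' ⟨M, h⟩ else 0) := by
      intro M hM; simp [not_le.mpr hM]
    refine ⟨_, hsupp, fun g => ?_⟩
    rw [fourierFn, sum_eq_sum_rankLE hsupp]
    simp only [levelMap, readout, LinearMap.coe_mk, AddHom.coe_mk]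
    refine Finset.sum_congr rfl fun M _ => ?_
    rw [dif_pos M.2]
  · rintro ⟨c, hc, hfc⟩
    refine ⟨fun M => c M.1, ?_⟩
    funext g
    rw [hfc g]
    exact readout_restrict _ hc g

/-- `dim F_k|_G ≤ N_k = #{M : rk M ≤ k}`. -/
theorem finrank_levelSubmodule_le :
    Module.finrank ℂ (levelSubmodule p m k) ≤ Fintype.card (RankLE p m k) := by
  have h := LinearMap.finrank_range_le (levelMap p m k)
  rwa [Module.finrank_fintype_fun_eq_card] at h

/-- `F_k|_G` is right-translation invariant. -/
theorem levelSubmodule_right_inv :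
    ∀ f ∈ levelSubmodule p m k, ∀ h : GLm p m, (fun g => f (g * h)) ∈ levelSubmodule p m k := by
  intro f hf h
  rw [mem_levelSubmodule_iff] at hf ⊢
  simpa using levelSet_transl hf h 1

/-- `F_k|_G` is left-translation invariant. -/
theorem levelSubmodule_left_inv :
    ∀ f ∈ levelSubmodule p m k, ∀ h : GLm p m, (fun g => f (h * g)) ∈ levelSubmodule p m k := by
  intro f hf h
  rw [mem_levelSubmodule_iff] at hf ⊢
  simpa using levelSet_transl hf 1 h

variable {X Y Z : Finset (GLm p m)}

/-- The crux's separation clause in the `GradedDesignFamily` format, with `J = F_k|_G`. -/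
theorem sep_clause_of_rankSep (hsep : RankSep k X Y Z) :
    ∀ x₀ ∈ X, ∀ z₀ ∈ Z, ∃ f ∈ levelSubmodule p m k, ∀ x ∈ X, ∀ y ∈ Y, ∀ y' ∈ Y, ∀ z ∈ Z,
      (x = x₀ ∧ y = y' ∧ z = z₀ → f (x⁻¹ * y * y'⁻¹ * z) = 1) ∧
      (¬ (x = x₀ ∧ y = y' ∧ z = z₀) → f (x⁻¹ * y * y'⁻¹ * z) = 0) := by
  intro x₀ hx₀ z₀ hz₀
  obtain ⟨c, hc, hsepc⟩ := hsep x₀ hx₀ z₀ hz₀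
  refine ⟨fourierFn c, mem_levelSubmodule_iff.mpr ⟨c, hc, fun g => rfl⟩,
    fun x hx y hy y' hy' z hz => ⟨fun h => ?_, fun h => ?_⟩⟩
  · rw [hsepc x hx y hy y' hy' z hz, if_pos h]
  · rw [hsepc x hx y hy y' hy' z hz, if_neg h]

/-- **Graded Neumann count for the crux, `X`-slab**: `|X||Z| + |X|(|Y| − 1) ≤ N_k`. -/
theorem neumann_X (hsep : RankSep k X Y Z) {y₁ z₁ : GLm p m} (hy₁ : y₁ ∈ Y) (hz₁ : z₁ ∈ Z) :
    X.card * Z.card + X.card * (Y.card - 1) ≤ Fintype.card (RankLE p m k) :=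
  (Summit.MatrixMultiplication.MatrixMultiplication.Theorems.LevelTwoBeatsCubes.Negative.packing_X (levelSubmodule p m k) levelSubmodule_right_inv X Y Z
    (sep_clause_of_rankSep hsep) hy₁ hz₁).trans finrank_levelSubmodule_le

/-- **Graded Neumann count for the crux, `Z`-slab**: `|X||Z| + (|Y| − 1)|Z| ≤ N_k`. -/
theorem neumann_Z (hsep : RankSep k X Y Z) {x₁ y₁ : GLm p m} (hx₁ : x₁ ∈ X) (hy₁ : y₁ ∈ Y) :
    X.card * Z.card + (Y.card - 1) * Z.card ≤ Fintype.card (RankLE p m k) :=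
  (Summit.MatrixMultiplication.MatrixMultiplication.Theorems.LevelTwoBeatsCubes.Negative.packing_Z (levelSubmodule p m k) levelSubmodule_left_inv X Y Z
    (sep_clause_of_rankSep hsep) hx₁ hy₁).trans finrank_levelSubmodule_le

/-- **Cubic volume budget for the crux**: any `B` with `4N_k + 1 ≤ 8B` and
`4(4N_k+1)³ ≤ 27(8B − 4N_k − 1)²` (the least such is `≈ 0.385·N_k^{3/2}`) bounds the volume of
every `F_k`-separated triple: `|X||Y||Z| ≤ B`.  (Compare the crux's demand
`|X||Y||Z| > B_k(2+ε)^{3/(2+ε)}`: the surviving window is `(B_k(2+ε)^{3/(2+ε)}, 0.385 N_k^{3/2}]`,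
non-empty for large `p` at every level because `R_k` contains `≈ p^k` near-maximal irreducibles —
unlike the `S_n` level-2 case, where this count refuted `LevelTwoBeatsCubes`.) -/
theorem volume_le_cubicBudget (hsep : RankSep k X Y Z) (B : ℕ)
    (h1 : (4 * (Fintype.card (RankLE p m k) : ℝ) + 1) ≤ 8 * B)
    (h2 : 4 * (4 * (Fintype.card (RankLE p m k) : ℝ) + 1) ^ 3 ≤
      27 * (8 * (B : ℝ) - 4 * Fintype.card (RankLE p m k) - 1) ^ 2) :
    X.card * Y.card * Z.card ≤ B := by
  obtain hX | ⟨x₁, hx₁⟩ := X.eq_empty_or_nonempty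
  · simp [hX]
  obtain hY | ⟨y₁, hy₁⟩ := Y.eq_empty_or_nonempty
  · simp [hY]
  obtain hZ | ⟨z₁, hz₁⟩ := Z.eq_empty_or_nonempty
  · simp [hZ]
  exact Summit.MatrixMultiplication.MatrixMultiplication.Theorems.LevelTwoBeatsCubes.Negative.vol_le _ _ _ _ B (Finset.card_pos.mpr ⟨y₁, hy₁⟩)
    (neumann_X hsep hy₁ hz₁) (neumann_Z hsep hx₁ hy₁)
    (Summit.MatrixMultiplication.MatrixMultiplication.Theorems.LevelTwoBeatsCubes.Negative.cubic_le_nat _ B h1 h2)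

end Neumann

/-! ## Orthogonality to `θ∘det` below the top level, and the PIGEONHOLE bound `|X||Y| + |Y||Z| ≤ |G|` -/

section Pigeonhole

variable [Fact p.Prime]

/-- The quadratic character of `𝔽_p` composed with `det`, as a complex-valued function on `GL_m`. -/
def detChar (p m : ℕ) [Fact p.Prime] (g : GLm p m) : ℂ :=
  ((quadraticChar (ZMod p) (g : Mat p m).det : ℤ) : ℂ)

/-- `θ∘det` is multiplicative. [folklore] -/
theorem detChar_mul (g h : GLm p m) : detChar p m (g * h) = detChar p m g * detChar p m h := by
  unfold detChar
  rw [Units.val_mul, Matrix.det_mul, map_mul, Int.cast_mul]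

/-- `θ∘det` does not vanish on `GL_m`. [folklore] -/
theorem detChar_ne_zero (g : GLm p m) : detChar p m g ≠ 0 := by
  unfold detChar
  have hdet : (g : Mat p m).det ≠ 0 := by
    rw [← Matrix.GeneralLinearGroup.val_det_apply]; exact Units.ne_zero _
  rcases quadraticChar_dichotomy hdet with h | h <;> rw [h] <;> norm_num

/-- A matrix of rank `< m` is fixed under right multiplication by some `H ∈ GL_m` of any prescribed
nonzero determinant `a`: `M H = M`, `det H = a` (rank-one correction along a kernel vector). -/
theorem exists_fixing_unit {M : Mat p m} (hM : M.rank < m) {a : ZMod p} (ha : a ≠ 0) :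
    ∃ h : GLm p m, M * (h : Mat p m) = M ∧ (h : Mat p m).det = a := by
  classical
  -- a nonzero kernel vector
  have hker : LinearMap.ker M.mulVecLin ≠ ⊥ := by
    intro hbot
    have h := LinearMap.finrank_range_add_finrank_ker M.mulVecLin
    rw [hbot, finrank_bot, add_zero, Module.finrank_fintype_fun_eq_card, Fintype.card_fin] at h
    unfold Matrix.rank at hM
    omega
  obtain ⟨u, hu, hu0⟩ := Submodule.exists_mem_ne_zero_of_ne_bot hker
  rw [LinearMap.mem_ker, Matrix.mulVecLin_apply] at hu
  obtain ⟨i, hi⟩ := Function.ne_iff.mp hu0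
  set v : Fin m → ZMod p := Pi.single i (u i)⁻¹ with hv
  have hvu : v ⬝ᵥ u = 1 := by
    rw [hv, single_dotProduct, inv_mul_cancel₀ hi]
  set H : Mat p m := 1 + Matrix.vecMulVec ((a - 1) • u) v with hH
  have hMH : M * H = M := by
    rw [hH, Matrix.mul_add, Matrix.mul_one, Matrix.mul_vecMulVec, Matrix.mulVec_smul, hu, smul_zero]
    ext i j
    simp
  have hdet : H.det = a := by
    rw [hH, Matrix.vecMulVec_eq Unit, Matrix.det_one_add_replicateCol_mul_replicateRow, dotProduct_smul,
      hvu, smul_eq_mul, mul_one]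
    ring
  refine ⟨Matrix.GeneralLinearGroup.mkOfDetNeZero H (by rw [hdet]; exact ha), ?_, ?_⟩
  · exact hMH
  · exact hdet

/-- **Twisted Gauss sums over `GL_m` vanish below full rank** (`p` odd): for `rk M < m`,
`Σ_{g ∈ GL_m(𝔽_p)} ψ(tr(M g)) · θ(det g) = 0`, `θ` the quadratic character. -/
theorem sum_psi_mul_detChar_eq_zero (hp : p ≠ 2) {M : Mat p m} (hM : M.rank < m) :
    ∑ g : GLm p m, ZMod.stdAddChar (Matrix.trace (M * (g : Mat p m))) * detChar p m g = 0 := by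
  classical
  have hch : ringChar (ZMod p) ≠ 2 := by rw [ZMod.ringChar_zmod_n]; exact hp
  obtain ⟨a, ha⟩ := quadraticChar_exists_neg_one hch
  have ha0 : a ≠ 0 := by rintro rfl; rw [quadraticChar_zero] at ha; norm_num at ha
  obtain ⟨h, hMh, hdet⟩ := exists_fixing_unit hM ha0
  have hθh : detChar p m h = -1 := by
    unfold detChar; rw [hdet, ha]; norm_num
  set F : GLm p m → ℂ := fun g => ZMod.stdAddChar (Matrix.trace (M * (g : Mat p m))) * detChar p m g
  have hF : ∀ g, F (h * g) = -F g := by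
    intro g
    simp only [F]
    rw [Units.val_mul, ← Matrix.mul_assoc, hMh, detChar_mul, hθh]
    ring
  have hsum : ∑ g, F g = ∑ g, F (h * g) := (Equiv.sum_comp (Equiv.mulLeft h) F).symm
  simp only [hF, Finset.sum_neg_distrib] at hsum
  have h2 : ∑ g, F g + ∑ g, F g = 0 := by nth_rewrite 2 [hsum]; ring
  exact add_self_eq_zero.mp h2

/-- **Every level-`k` function, `k < m`, is orthogonal to `θ∘det`** (`p` odd). -/
theorem sum_fourierFn_mul_detChar_eq_zero (hp : p ≠ 2) {k : ℕ} (hkm : k < m) {c : Mat p m → ℂ}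
    (hc : RankSupp k c) : ∑ g : GLm p m, fourierFn c g * detChar p m g = 0 := by
  unfold fourierFn
  simp_rw [Finset.sum_mul]
  rw [Finset.sum_comm]
  refine Finset.sum_eq_zero fun M _ => ?_
  by_cases hMk : k < M.rank
  · simp [hc M hMk]
  · simp_rw [mul_assoc]
    rw [← Finset.mul_sum, sum_psi_mul_detChar_eq_zero hp (by omega), mul_zero]

/-- In particular a delta function is never of level `k < m` (`p` odd). -/
theorem delta_not_mem_levelSet (hp : p ≠ 2) {k : ℕ} (hkm : k < m) (g₀ : GLm p m) :
    (fun g => if g = g₀ then (1 : ℂ) else 0) ∉ levelSet p m k := by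
  classical
  rintro ⟨c, hc, hfc⟩
  have h := sum_fourierFn_mul_detChar_eq_zero hp hkm hc
  have : ∑ g : GLm p m, fourierFn c g * detChar p m g = detChar p m g₀ := by
    simp_rw [← hfc]
    simp [Finset.sum_ite_eq']
  rw [this] at h
  exact detChar_ne_zero g₀ h

variable {k : ℕ} {X Y Z : Finset (GLm p m)}

/-- Separation makes `(x, y) ↦ x⁻¹ y` injective on `X × Y` (given some `z₀ ∈ Z`). -/
theorem card_image_XY (hsep : RankSep k X Y Z) (hZ : Z.Nonempty) :
    ((X ×ˢ Y).image fun t => t.1⁻¹ * t.2).card = X.card * Y.card := by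
  classical
  obtain ⟨z₀, hz₀⟩ := hZ
  rw [← Finset.card_product]
  refine Finset.card_image_of_injOn ?_
  rintro ⟨x₁, y₁⟩ h₁ ⟨x₂, y₂⟩ h₂ heq
  simp only [Finset.coe_product, Set.mem_prod, Finset.mem_coe] at h₁ h₂
  simp only at heq
  obtain ⟨c, -, hsepc⟩ := hsep x₁ h₁.1 z₀ hz₀
  have ht := hsepc x₁ h₁.1 y₁ h₁.2 y₁ h₁.2 z₀ hz₀
  rw [if_pos ⟨rfl, rfl, rfl⟩] at ht
  have h' := hsepc x₂ h₂.1 y₂ h₂.2 y₁ h₁.2 z₀ hz₀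
  rw [show x₂⁻¹ * y₂ * y₁⁻¹ * z₀ = x₁⁻¹ * y₁ * y₁⁻¹ * z₀ by rw [heq], ht] at h'
  by_contra hne
  rw [if_neg] at h'
  · exact one_ne_zero h'
  · rintro ⟨rfl, rfl, -⟩; exact hne rfl

/-- Separation makes `(y', z) ↦ y'⁻¹ z` injective on `Y × Z` (given some `x₀ ∈ X`). -/
theorem card_image_YZ (hsep : RankSep k X Y Z) (hX : X.Nonempty) :
    ((Y ×ˢ Z).image fun t => t.1⁻¹ * t.2).card = Y.card * Z.card := by
  classical
  obtain ⟨x₀, hx₀⟩ := hX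
  rw [← Finset.card_product]
  refine Finset.card_image_of_injOn ?_
  rintro ⟨y₁, z₁⟩ h₁ ⟨y₂, z₂⟩ h₂ heq
  simp only [Finset.coe_product, Set.mem_prod, Finset.mem_coe] at h₁ h₂
  simp only at heq
  obtain ⟨c, -, hsepc⟩ := hsep x₀ hx₀ z₁ h₁.2
  have ht := hsepc x₀ hx₀ y₁ h₁.1 y₁ h₁.1 z₁ h₁.2
  rw [if_pos ⟨rfl, rfl, rfl⟩] at ht
  have h' := hsepc x₀ hx₀ y₁ h₁.1 y₂ h₂.1 z₂ h₂.2
  rw [show x₀⁻¹ * y₁ * y₂⁻¹ * z₂ = x₀⁻¹ * y₁ * y₁⁻¹ * z₁ by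
    rw [mul_assoc, ← heq, ← mul_assoc], ht] at h'
  by_contra hne
  rw [if_neg] at h'
  · exact one_ne_zero h'
  · rintro ⟨-, rfl, rfl⟩; exact hne rfl

/-- Pigeonhole in a finite group: if `|A| + |B| > |G|` then `A · B = G`. -/
theorem exists_mul_eq_of_card_lt {G : Type} [Group G] [Fintype G] [DecidableEq G] (A B : Finset G)
    (h : Fintype.card G < A.card + B.card) (g : G) : ∃ a ∈ A, ∃ b ∈ B, a * b = g := by
  set A' := A.image fun a => a⁻¹ * g with hA'
  have hcard : A'.card = A.card := by
    refine Finset.card_image_of_injective _ fun a₁ a₂ h12 => ?_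
    simpa using h12
  have hnd : ¬ Disjoint A' B := by
    intro hd
    have := Finset.card_le_univ (A' ∪ B)
    rw [Finset.card_union_of_disjoint hd, hcard] at this
    omega
  obtain ⟨b, hb, hbA⟩ : ∃ b ∈ B, b ∈ A' := by
    simpa [Finset.not_disjoint_iff, and_comm] using hnd
  rw [hA', Finset.mem_image] at hbA
  obtain ⟨a, ha, rfl⟩ := hbA
  exact ⟨a, ha, _, hb, by group⟩

/-- **PIGEONHOLE BOUND.**  For `p` odd and `k < m`, an `F_k`-separated triple with `X, Z ≠ ∅`
satisfies `|X|·|Y| + |Y|·|Z| ≤ |GL_m(𝔽_p)|`: otherwise `X⁻¹Y · Y⁻¹Z = G`, the separating function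
of a target is then forced to be a delta function on all of `G`, and delta functions are not of
level `k < m` (`delta_not_mem_levelSet`).  (Kills e.g. the `(5,5,5)` pattern in `GL_2(𝔽_3)`.) -/
theorem card_XY_add_card_YZ_le (hp : p ≠ 2) (hkm : k < m) (hsep : RankSep k X Y Z)
    (hX : X.Nonempty) (hZ : Z.Nonempty) :
    X.card * Y.card + Y.card * Z.card ≤ Fintype.card (GLm p m) := by
  classical
  by_contra hlt
  push Not at hlt
  rw [← card_image_XY hsep hZ, ← card_image_YZ hsep hX] at hlt
  obtain ⟨x₀, hx₀⟩ := hX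
  obtain ⟨z₀, hz₀⟩ := hZ
  obtain ⟨c, hc, hsepc⟩ := hsep x₀ hx₀ z₀ hz₀
  apply delta_not_mem_levelSet hp hkm (x₀⁻¹ * z₀)
  refine ⟨c, hc, fun g => ?_⟩
  obtain ⟨a, ha, b, hb, hab⟩ := exists_mul_eq_of_card_lt _ _ hlt g
  rw [Finset.mem_image] at ha hb
  obtain ⟨⟨x, y⟩, hxy, rfl⟩ := ha
  obtain ⟨⟨y', z⟩, hyz, rfl⟩ := hb
  rw [Finset.mem_product] at hxy hyz
  simp only at hab hxy hyz
  have hval := hsepc x hxy.1 y hxy.2 y' hyz.1 z hyz.2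
  rw [show x⁻¹ * y * y'⁻¹ * z = g by rw [← hab]; group] at hval
  show (if g = x₀⁻¹ * z₀ then (1 : ℂ) else 0) = fourierFn c g
  rw [hval]
  by_cases hg : g = x₀⁻¹ * z₀
  · rw [if_pos hg]
    -- the value at the target is 1, computed from the target quadruple (x₀, y, y, z₀)
    have h1 := hsepc x₀ hx₀ y hxy.2 y hxy.2 z₀ hz₀
    rw [if_pos ⟨rfl, rfl, rfl⟩, show x₀⁻¹ * y * y⁻¹ * z₀ = g by rw [hg]; group] at h1
    rw [← hval, h1]
  · rw [if_neg hg, if_neg]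
    rintro ⟨rfl, rfl, rfl⟩
    exact hg (by rw [← hab]; group)

end Pigeonhole



/-! ## ISOTROPY of low levels and the bound `|X||Z| + |X⁻¹YY⁻¹Z| ≤ |G|` (`p` odd, `2k < m`) -/

section Isotropy

variable [Fact p.Prime]

/-- Rank is subadditive. [folklore] -/
theorem rank_add_le (A B : Mat p m) : (A + B).rank ≤ A.rank + B.rank := by
  unfold Matrix.rank
  rw [Matrix.mulVecLin_add]
  exact (Submodule.finrank_mono (LinearMap.range_add_le _ _)).trans
    (Submodule.finrank_add_le_finrank_add_finrank _ _)

/-- **Low levels are `θ∘det`-isotropic**: for `p` odd and `2k < m`, the pointwise product of two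
level-`k` functions has Fourier support in rank `≤ 2k < m`, hence is orthogonal to `θ∘det`:
`Σ_g f₁(g) f₂(g) θ(det g) = 0`. -/
theorem sum_fourierFn_mul_fourierFn_mul_detChar_eq_zero (hp : p ≠ 2) {k : ℕ} (hkm : 2 * k < m)
    {c c' : Mat p m → ℂ} (hc : RankSupp k c) (hc' : RankSupp k c') :
    ∑ g : GLm p m, fourierFn c g * fourierFn c' g * detChar p m g = 0 := by
  have key : ∀ M M' : Mat p m, c M * c' M' *
      ∑ g : GLm p m, ZMod.stdAddChar (Matrix.trace ((M + M') * (g : Mat p m))) * detChar p m g = 0 := by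
    intro M M'
    by_cases hM : k < M.rank
    · rw [hc M hM]; simp
    by_cases hM' : k < M'.rank
    · rw [hc' M' hM']; simp
    rw [sum_psi_mul_detChar_eq_zero hp (lt_of_le_of_lt (rank_add_le M M') (by omega)), mul_zero]
  unfold fourierFn
  calc ∑ g : GLm p m, (∑ M : Mat p m, c M * ZMod.stdAddChar (Matrix.trace (M * (g : Mat p m)))) *
        (∑ M' : Mat p m, c' M' * ZMod.stdAddChar (Matrix.trace (M' * (g : Mat p m)))) * detChar p m g
      = ∑ g : GLm p m, ∑ M : Mat p m, ∑ M' : Mat p m, c M * c' M' *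
          (ZMod.stdAddChar (Matrix.trace ((M + M') * (g : Mat p m))) * detChar p m g) := by
        refine Finset.sum_congr rfl fun g _ => ?_
        rw [Finset.sum_mul, Finset.sum_mul]
        refine Finset.sum_congr rfl fun M _ => ?_
        rw [Finset.mul_sum, Finset.sum_mul]
        refine Finset.sum_congr rfl fun M' _ => ?_
        rw [Matrix.add_mul, Matrix.trace_add, AddChar.map_add_eq_mul]
        ring
    _ = ∑ M : Mat p m, ∑ M' : Mat p m, c M * c' M' *
          ∑ g : GLm p m, ZMod.stdAddChar (Matrix.trace ((M + M') * (g : Mat p m))) * detChar p m g := by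
        rw [Finset.sum_comm]
        refine Finset.sum_congr rfl fun M _ => ?_
        rw [Finset.sum_comm]
        refine Finset.sum_congr rfl fun M' _ => ?_
        rw [Finset.mul_sum]
    _ = 0 := Finset.sum_eq_zero fun M _ => Finset.sum_eq_zero fun M' _ => key M M'

/-- The quadruple-product set `P = X⁻¹ Y Y⁻¹ Z` of a triple (the support the separating functions
are pinned on). -/
def quadProducts (X Y Z : Finset (GLm p m)) : Finset (GLm p m) :=
  ((X ×ˢ Y) ×ˢ (Y ×ˢ Z)).image fun q => q.1.1⁻¹ * q.1.2 * q.2.1⁻¹ * q.2.2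

variable {k : ℕ} {X Y Z : Finset (GLm p m)}

theorem mem_quadProducts {x y y' z : GLm p m} (hx : x ∈ X) (hy : y ∈ Y) (hy' : y' ∈ Y) (hz : z ∈ Z) :
    x⁻¹ * y * y'⁻¹ * z ∈ quadProducts X Y Z :=
  Finset.mem_image.mpr ⟨((x, y), (y', z)), by simp [hx, hy, hy', hz], rfl⟩

/-- On `P` a separating function is the delta function of its target. [folklore] -/
theorem sep_apply_of_mem_quadProducts {x₀ z₀ : GLm p m} (hx₀ : x₀ ∈ X) (hz₀ : z₀ ∈ Z)
    {c : Mat p m → ℂ}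
    (hsepc : ∀ x ∈ X, ∀ y ∈ Y, ∀ y' ∈ Y, ∀ z ∈ Z,
      fourierFn c (x⁻¹ * y * y'⁻¹ * z) = if x = x₀ ∧ y = y' ∧ z = z₀ then 1 else 0)
    {g : GLm p m} (hg : g ∈ quadProducts X Y Z) :
    fourierFn c g = if g = x₀⁻¹ * z₀ then 1 else 0 := by
  classical
  rw [quadProducts, Finset.mem_image] at hg
  obtain ⟨⟨⟨x, y⟩, ⟨y', z⟩⟩, hq, rfl⟩ := hg
  simp only [Finset.mem_product] at hq
  rw [hsepc x hq.1.1 y hq.1.2 y' hq.2.1 z hq.2.2]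
  by_cases h : x⁻¹ * y * y'⁻¹ * z = x₀⁻¹ * z₀
  · rw [if_pos h]
    have h1 := hsepc x₀ hx₀ y hq.1.2 y hq.1.2 z₀ hz₀
    rw [if_pos ⟨rfl, rfl, rfl⟩, show x₀⁻¹ * y * y⁻¹ * z₀ = x₀⁻¹ * z₀ by group, ← h,
      hsepc x hq.1.1 y hq.1.2 y' hq.2.1 z hq.2.2] at h1
    exact h1
  · rw [if_neg h, if_neg]
    rintro ⟨rfl, rfl, rfl⟩
    exact h (by group)

/-- **ISOTROPY BOUND.**  For `p` odd and `2k < m`, an `F_k`-separated triple with `Y ≠ ∅` satisfies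
`|X|·|Z| + |X⁻¹ Y Y⁻¹ Z| ≤ |GL_m(𝔽_p)|`: the quadruple-product set must MISS at least `|X||Z|`
group elements.  Proof: the separating functions `f_t` (`t ∈ X⁻¹Z`) are `θ∘det`-isotropic
(`Σ f_t f_{t'} θ = 0`) and equal `δ_t` on `P`, so their restrictions to `G ∖ P` have the invertible
Gram matrix `−diag(θ(det t))` and are linearly independent in `ℂ^{G∖P}`. -/
theorem card_XZ_add_card_quadProducts_le (hp : p ≠ 2) (hkm : 2 * k < m) (hsep : RankSep k X Y Z)
    (hY : Y.Nonempty) :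
    X.card * Z.card + (quadProducts X Y Z).card ≤ Fintype.card (GLm p m) := by
  classical
  obtain ⟨y₀, hy₀⟩ := hY
  set P := quadProducts X Y Z with hPdef
  set T : Type := ↥(X ×ˢ Z)
  -- separating tables, one per target pair
  have hq : ∀ q : T, ∃ c : Mat p m → ℂ, RankSupp k c ∧ ∀ x ∈ X, ∀ y ∈ Y, ∀ y' ∈ Y, ∀ z ∈ Z,
      fourierFn c (x⁻¹ * y * y'⁻¹ * z) = if x = q.1.1 ∧ y = y' ∧ z = q.1.2 then 1 else 0 :=
    fun q => hsep q.1.1 (Finset.mem_product.mp q.2).1 q.1.2 (Finset.mem_product.mp q.2).2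
  choose c hc hsepc using hq
  set t : T → GLm p m := fun q => q.1.1⁻¹ * q.1.2 with htdef
  have ht_mem : ∀ q : T, t q ∈ P := fun q => by
    rw [show t q = q.1.1⁻¹ * y₀ * y₀⁻¹ * q.1.2 by simp only [htdef]; group]
    exact mem_quadProducts (Finset.mem_product.mp q.2).1 hy₀ hy₀ (Finset.mem_product.mp q.2).2
  have hfP : ∀ q : T, ∀ g ∈ P, fourierFn (c q) g = if g = t q then 1 else 0 := fun q g hg =>
    sep_apply_of_mem_quadProducts (Finset.mem_product.mp q.2).1 (Finset.mem_product.mp q.2).2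
      (hsepc q) hg
  have ht_inj : ∀ q q' : T, t q = t q' → q = q' := by
    intro q q' he
    have h1 := hfP q (t q) (ht_mem q)
    rw [if_pos rfl] at h1
    have h2 := hsepc q q'.1.1 (Finset.mem_product.mp q'.2).1 y₀ hy₀ y₀ hy₀ q'.1.2
      (Finset.mem_product.mp q'.2).2
    rw [show q'.1.1⁻¹ * y₀ * y₀⁻¹ * q'.1.2 = t q' by simp only [htdef]; group, ← he, h1] at h2
    by_cases hc' : q'.1.1 = q.1.1 ∧ y₀ = y₀ ∧ q'.1.2 = q.1.2
    · exact Subtype.ext (Prod.ext hc'.1.symm hc'.2.2.symm)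
    · rw [if_neg hc'] at h2; exact absurd h2 one_ne_zero
  -- the complement E = G \ P and the two matrices
  set E := (Finset.univ : Finset (GLm p m)) \ P with hEdef
  set Emat : Matrix T ↥E ℂ := fun q g => fourierFn (c q) g with hEmat
  set Dθ : Matrix ↥E ↥E ℂ := Matrix.diagonal fun g => detChar p m g with hDθ
  have hgram : Emat * Dθ * Emat.transpose = -Matrix.diagonal fun q => detChar p m (t q) := by
    ext q q'
    rw [Matrix.mul_apply]
    simp only [hDθ, Matrix.mul_diagonal, Matrix.transpose_apply, Matrix.neg_apply,
      Matrix.diagonal_apply]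
    -- Σ over ↥E as a Finset sum
    rw [show (∑ g : ↥E, Emat q g * detChar p m g * Emat q' g) =
        ∑ g ∈ E, fourierFn (c q) g * fourierFn (c q') g * detChar p m g from by
      rw [← Finset.sum_coe_sort E]
      refine Finset.sum_congr rfl fun g _ => ?_
      simp only [hEmat]; ring]
    have htot := sum_fourierFn_mul_fourierFn_mul_detChar_eq_zero hp hkm (hc q) (hc q')
    rw [← Finset.sum_sdiff (Finset.subset_univ P)] at htot
    have hP : ∑ g ∈ P, fourierFn (c q) g * fourierFn (c q') g * detChar p m g =
        if q = q' then detChar p m (t q) else 0 := by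
      rw [Finset.sum_congr rfl fun g hg => by rw [hfP q g hg, hfP q' g hg]]
      simp only [ite_mul, one_mul, zero_mul]
      rw [Finset.sum_ite_eq' P (t q), if_pos (ht_mem q)]
      by_cases hqq : q = q'
      · subst hqq; simp
      · rw [if_neg (fun h => hqq (ht_inj q q' h)), if_neg hqq]
    rw [hP] at htot
    have : ∑ g ∈ E, fourierFn (c q) g * fourierFn (c q') g * detChar p m g =
        -(if q = q' then detChar p m (t q) else 0) := eq_neg_of_add_eq_zero_left htot
    rw [this]
  -- ranks
  have hunit : IsUnit (-Matrix.diagonal fun q : T => detChar p m (t q)) := by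
    rw [Matrix.diagonal_neg, Matrix.isUnit_diagonal, Pi.isUnit_iff]
    exact fun q => isUnit_iff_ne_zero.mpr (neg_ne_zero.mpr (detChar_ne_zero _))
  have hrank : Fintype.card T ≤ Fintype.card ↥E := by
    calc Fintype.card T = (-Matrix.diagonal fun q : T => detChar p m (t q)).rank :=
          (Matrix.rank_of_isUnit _ hunit).symm
      _ = (Emat * Dθ * Emat.transpose).rank := by rw [hgram]
      _ ≤ (Emat * Dθ).rank := Matrix.rank_mul_le_left _ _
      _ ≤ Emat.rank := Matrix.rank_mul_le_left _ _
      _ ≤ Fintype.card ↥E := Matrix.rank_le_card_width _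
  rw [Fintype.card_coe, Finset.card_product, Fintype.card_coe, hEdef, Finset.card_univ_sdiff] at hrank
  have hPle : P.card ≤ Fintype.card (GLm p m) := Finset.card_le_univ P
  omega

/-- `|X⁻¹ Y Y⁻¹ Z| ≥ |X|·|Y|` for a separated triple with `Z ≠ ∅` (a translate of `X⁻¹Y` sits
inside, injectively). [folklore] -/
theorem card_XY_le_card_quadProducts (hsep : RankSep k X Y Z) (hZ : Z.Nonempty) :
    X.card * Y.card ≤ (quadProducts X Y Z).card := by
  classical
  obtain ⟨z₀, hz₀⟩ := hZ
  obtain hY | ⟨y₀, hy₀⟩ := Y.eq_empty_or_nonempty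
  · simp [hY]
  rw [← card_image_XY hsep ⟨z₀, hz₀⟩]
  refine (Finset.card_le_card_of_injOn (fun a => a * (y₀⁻¹ * z₀)) (fun a ha => ?_)
    (fun a _ b _ h => mul_right_cancel h))
  rw [Finset.mem_coe, Finset.mem_image] at ha
  obtain ⟨⟨x, y⟩, hxy, rfl⟩ := ha
  rw [Finset.mem_product] at hxy
  simpa [mul_assoc] using mem_quadProducts hxy.1 hxy.2 hy₀ hz₀

/-- **Corollary**: `p` odd, `2k < m`, all three sets nonempty ⇒ `|X||Z| + |X||Y| ≤ |GL_m(𝔽_p)|`. -/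
theorem card_XZ_add_card_XY_le (hp : p ≠ 2) (hkm : 2 * k < m) (hsep : RankSep k X Y Z)
    (hY : Y.Nonempty) (hZ : Z.Nonempty) :
    X.card * Z.card + X.card * Y.card ≤ Fintype.card (GLm p m) :=
  le_trans (Nat.add_le_add_left (card_XY_le_card_quadProducts hsep hZ) _)
    (card_XZ_add_card_quadProducts_le hp hkm hsep hY)

end Isotropy

/-! ## TIGHTNESS: at level `0` the budget is exactly `1`, and the `≤`-variant of the crux is trivially true -/

section Tightness

variable [Fact p.Prime]

/-- A constant irreducible character is the trivial character (`⟨χ, χ⟩ = 1` forces the constant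
to be `±1`, and `χ(1) = dim ≥ 0`). -/
theorem eq_trivial_of_const {G : Type} [Group G] [Fintype G] {χ : G → ℂ} (hχ : χ ∈ irrChars G)
    {K : ℂ} (hK : ∀ g, χ g = K) : χ = (Representation.trivial ℂ G ℂ).character := by
  classical
  have h1 : classInner χ χ = 1 := by rw [IsIrrChar.classInner_eq hχ hχ, if_pos rfl]
  rw [classInner_apply] at h1
  simp_rw [hK] at h1
  rw [Finset.sum_const, Finset.card_univ, nsmul_eq_mul, ← mul_assoc, inv_mul_cancel₀
    (Nat.cast_ne_zero.mpr Fintype.card_ne_zero), one_mul] at h1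
  obtain ⟨d, -, hd⟩ := IsIrrChar.exists_apply_one hχ
  have hKd : K = d := (hK 1).symm.trans hd
  rw [hKd] at h1
  have hd1 : d = 1 := by
    have : (d : ℂ) * d = (d * d : ℕ) := by push_cast; ring
    rw [this, show (1 : ℂ) = ((1 : ℕ) : ℂ) from Nat.cast_one.symm] at h1
    have h2 : d * d = 1 := Nat.cast_injective h1
    exact Nat.eq_one_of_mul_eq_one_left h2
  funext g
  rw [hK, character_trivial_apply, hKd, hd1, Nat.cast_one]

/-- **At level `0` the graded budget is exactly `1`** (only the trivial character is constant). -/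
theorem budget_levelZero (s : ℝ) : budget p m 0 s = 1 := by
  have hset : irrChars (GLm p m) ∩ levelSet p m 0 =
      {(Representation.trivial ℂ (GLm p m) ℂ).character} := by
    ext χ
    constructor
    · rintro ⟨hχ, c, hc, hfc⟩
      exact eq_trivial_of_const hχ (K := c 0) fun g => by
        rw [hfc, fourierFn_const_of_rankSupp_zero hc]
    · rintro rfl
      exact trivial_mem_levelSet 0
  unfold budget
  rw [hset, finsum_mem_singleton, character_trivial_apply]
  simp

/-- The singleton design is `F_0`-separated. -/
theorem rankSep_singleton : RankSep (p := p) (m := m) 0 {1} {1} {1} := by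
  intro x₀ hx₀ z₀ hz₀
  refine ⟨constCoeff p m, rankSupp_constCoeff 0, fun x hx y hy y' hy' z hz => ?_⟩
  rw [Finset.mem_singleton] at hx₀ hz₀ hx hy hy' hz
  subst hx₀ hz₀ hx hy hy' hz
  rw [fourierFn_constCoeff, if_pos ⟨rfl, rfl, rfl⟩]

end Tightness

/-- **WEAKENING IS TRIVIAL (`≤` for `<`).**  With the strict inequality relaxed to `≤`, the crux holds
for every `ε > 0` by the singleton design at level `0` (budget `= 1 = 1^{(2+ε)/3}`): the strictness of
`<` in `LieRankDesigns` is load-bearing, and the crux is TIGHT at the trivial design. -/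
theorem lieRankDesigns_le_variant :
    ∀ ε : ℝ, 0 < ε → ∃ (p : ℕ) (_ : Fact p.Prime) (m k : ℕ) (X Y Z : Finset (GLm p m)),
      RankSep k X Y Z ∧ budget p m k (2 + ε) ≤ volume X Y Z ^ ((2 + ε) / 3) := by
  intro ε _
  refine ⟨2, ⟨Nat.prime_two⟩, 1, 0, {1}, {1}, {1}, rankSep_singleton, ?_⟩
  rw [budget_levelZero]
  simp [volume]


/-! ## Separation implies the triple product property (so every catalogued TPP cap applies) -/

section TPP

variable [Fact p.Prime] {k : ℕ} {X Y Z : Finset (GLm p m)}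

/-- **`F_k`-separation ⇒ TPP** (the tree's `TripleProductProperty`, Cohn–Umans Def. 2.1): from
`s s'⁻¹ · t t'⁻¹ · u u'⁻¹ = 1` one gets `s'⁻¹ t t'⁻¹ u = s⁻¹ t t⁻¹ u'`, and the separating function of
the target `(s, u')` takes the value `1` there, forcing `s' = s`, `t = t'`, `u = u'`. Hence
`BCGPU2023_thm32` / `cor35` (QuasirandomBarrier) bound the volume of every witness of the crux. -/
theorem tpp_of_rankSep (hsep : RankSep k X Y Z) :
    Literature.Combinatorics.Additive.TripleProductProperty X Y Z := by
  intro s hs s' hs' t ht t' ht' u hu u' hu' h1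
  obtain ⟨c, -, hsepc⟩ := hsep s hs u' hu'
  have htarget := hsepc s hs t ht t ht u' hu'
  rw [if_pos ⟨rfl, rfl, rfl⟩] at htarget
  have hother := hsepc s' hs' t ht t' ht' u hu
  have heq : s'⁻¹ * t * t'⁻¹ * u = s⁻¹ * t * t⁻¹ * u' := by
    have h2 : s'⁻¹ * t * t'⁻¹ * u = s⁻¹ * (s * s'⁻¹ * (t * t'⁻¹) * (u * u'⁻¹)) * u' := by group
    rw [h1] at h2
    rw [h2]; group
  rw [heq, htarget] at hother
  by_cases hc : s' = s ∧ t = t' ∧ u = u'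
  · exact ⟨hc.1.symm, hc.2.1, hc.2.2⟩
  · rw [if_neg hc] at hother
    exact absurd hother one_ne_zero

/-- Consequence: the Cohn–Umans / BCGPU packing cap `|X||Y||Z| ≤ |G|^{3/2}/√2 + |G|` (the tree's
`BCGPU2023_cor35`, proved in `QuasirandomBarrierProofs`) applies to every `F_k`-separated triple —
stated here modulo the named fact to keep this file's imports light. -/
theorem volume_le_of_cor35 (h35 : Literature.Barriers.MatrixMultiplication.BCGPU2023_cor35)
    (hsep : RankSep k X Y Z) :
    volume X Y Z ≤ (Fintype.card (GLm p m) : ℝ) ^ (3 / 2 : ℝ) / Real.sqrt 2 + Fintype.card (GLm p m) :=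
  h35 (GLm p m) X Y Z (tpp_of_rankSep hsep)

end TPP


/-! ## The abelian slice `m = 1` is dead for `ε ≤ 1` -/

section Abelian

/-- `GL_1(𝔽_p)` is commutative. [folklore] -/
theorem glOne_comm (a b : GLm p 1) : a * b = b * a := by
  apply Units.ext
  ext i j
  fin_cases i; fin_cases j
  simp [Matrix.mul_apply, mul_comm]

/-- `M_1(𝔽_p) ≃ 𝔽_p` (the unique entry). [folklore] -/
def matOneEquiv (p : ℕ) : Mat p 1 ≃ ZMod p where
  toFun M := M 0 0
  invFun a := Matrix.of fun _ _ => a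
  left_inv M := by
    ext i j; fin_cases i; fin_cases j; rfl
  right_inv a := rfl

variable [Fact p.Prime]

/-- Orthogonality of additive characters on `1 × 1` matrices:
`Σ_{M ∈ M_1(𝔽_p)} ψ(tr(M D)) = p·[D = 0]`. [folklore] -/
theorem sum_psi_matOne (D : Mat p 1) :
    ∑ M : Mat p 1, ZMod.stdAddChar (Matrix.trace (M * D)) = if D = 0 then (p : ℂ) else 0 := by
  classical
  have h := AddChar.sum_mulShift (R := ZMod p) (D 0 0) (ZMod.isPrimitive_stdAddChar p)
  rw [← Equiv.sum_comp (matOneEquiv p).symm]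
  have hterm : ∀ a : ZMod p, ZMod.stdAddChar (Matrix.trace ((matOneEquiv p).symm a * D)) =
      ZMod.stdAddChar (a * D 0 0) := by
    intro a
    congr 1
    rw [Matrix.trace_fin_one, Matrix.mul_apply]
    simp [matOneEquiv]
  simp_rw [hterm]
  rw [h]
  have hD : D 0 0 = 0 ↔ D = 0 := by
    constructor
    · intro h0; ext i j; fin_cases i; fin_cases j; exact h0
    · intro h0; rw [h0]; rfl
  by_cases hD0 : D = 0
  · rw [if_pos (hD.mpr hD0), if_pos hD0, ZMod.card]
  · rw [if_neg (fun h0 => hD0 (hD.mp h0)), if_neg hD0, Nat.cast_zero]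

/-- **Fourier inversion on `GL_1(𝔽_p)`**: for `k ≥ 1` every function is of level `k`, i.e.
`levelSet p 1 k = univ` (so the graded budget at `m = 1` is the FULL budget). [folklore] -/
theorem levelSet_matOne_eq_univ {k : ℕ} (hk : 1 ≤ k) : levelSet p 1 k = Set.univ := by
  classical
  refine Set.eq_univ_of_forall fun f => ?_
  have hp0 : (p : ℂ) ≠ 0 := Nat.cast_ne_zero.mpr (NeZero.ne p)
  refine ⟨fun M => (p : ℂ)⁻¹ * ∑ h : GLm p 1, f h * ZMod.stdAddChar (Matrix.trace (M * (-(h : Mat p 1)))),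
    ?_, fun g => ?_⟩
  · intro M hM
    exfalso
    have := Matrix.rank_le_width M
    omega
  · unfold fourierFn
    -- expand and swap the sums
    have hexp : ∀ M : Mat p 1,
        ((p : ℂ)⁻¹ * ∑ h : GLm p 1, f h * ZMod.stdAddChar (Matrix.trace (M * (-(h : Mat p 1))))) *
          ZMod.stdAddChar (Matrix.trace (M * (g : Mat p 1))) =
        (p : ℂ)⁻¹ * ∑ h : GLm p 1, f h * ZMod.stdAddChar (Matrix.trace (M * ((g : Mat p 1) - (h : Mat p 1)))) := by
      intro M
      rw [mul_assoc, Finset.sum_mul]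
      congr 1
      refine Finset.sum_congr rfl fun h _ => ?_
      rw [mul_assoc, ← AddChar.map_add_eq_mul, ← Matrix.trace_add, ← Matrix.mul_add,
        neg_add_eq_sub]
    simp_rw [hexp]
    rw [← Finset.mul_sum, Finset.sum_comm]
    simp_rw [← Finset.mul_sum, sum_psi_matOne, sub_eq_zero]
    have hval : ∀ h : GLm p 1, f h * (if ((g : Mat p 1) = (h : Mat p 1)) then (p : ℂ) else 0) =
        if g = h then f g * p else 0 := by
      intro h
      by_cases hgh : g = h
      · subst hgh; simp
      · rw [if_neg (fun e => hgh (Units.ext e)), if_neg hgh, mul_zero]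
    simp_rw [hval]
    rw [Finset.sum_ite_eq, if_pos (Finset.mem_univ _), ← mul_assoc, mul_comm ((p : ℂ)⁻¹),
      mul_assoc, inv_mul_cancel₀ hp0, mul_one]

/-- For a commutative group all irreducible characters have `χ(1) = 1`, so the FULL budget equals
`|G|` for every exponent: here `budget p 1 k s = |GL_1(𝔽_p)| = p − 1` for `k ≥ 1`. [folklore] -/
theorem budget_matOne {k : ℕ} (hk : 1 ≤ k) (s : ℝ) :
    budget p 1 k s = Fintype.card (GLm p 1) := by
  classical
  haveI : IsMulCommutative (GLm p 1) := ⟨⟨glOne_comm⟩⟩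
  have hone : ∀ χ ∈ irrChars (GLm p 1), χ 1 = 1 := by
    rintro χ ⟨V, _, _, _, ρ, hρ, rfl⟩
    haveI := hρ
    rw [Representation.char_one, Representation.IsIrreducible.finrank_eq_one_of_isMulCommutative ρ,
      Nat.cast_one]
  have hfin : (irrChars (GLm p 1)).Finite := irrChars_finite_holds _
  -- number of irreducible characters = |G| via `∑ χ(1)² = |G|`
  have hcount : (hfin.toFinset.card : ℂ) = Fintype.card (GLm p 1) := by
    have h := sum_sq_charDegrees_holds (GLm p 1)
    rw [finsum_mem_eq_finite_toFinset_sum _ hfin, Nat.card_eq_fintype_card] at h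
    rw [← h, Finset.sum_congr rfl fun χ hχ => by rw [hone χ (hfin.mem_toFinset.mp hχ), one_pow],
      Finset.sum_const, nsmul_eq_mul, mul_one]
  have hcount' : hfin.toFinset.card = Fintype.card (GLm p 1) := by exact_mod_cast hcount
  unfold budget
  rw [levelSet_matOne_eq_univ hk, Set.inter_univ, finsum_mem_eq_finite_toFinset_sum _ hfin,
    Finset.sum_congr rfl fun χ hχ => by rw [hone χ (hfin.mem_toFinset.mp hχ), Complex.one_re,
      Real.one_rpow], Finset.sum_const, nsmul_eq_mul, mul_one, hcount']

variable {k : ℕ} {X Y Z : Finset (GLm p 1)}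

/-- No design in `GL_1(𝔽_p)` beats an exponent `2 + ε` with `0 < ε ≤ 1`: for `k = 0` by
`not_design_levelZero`; for `k ≥ 1` the budget is `|G| ≥ |X||Y||Z| ≥ V^{(2+ε)/3}` (abelian TPP bound). -/
theorem not_design_matOne {ε : ℝ} (hε : 0 < ε) (hε1 : ε ≤ 1) (hsep : RankSep k X Y Z) :
    ¬ budget p 1 k (2 + ε) < volume X Y Z ^ ((2 + ε) / 3) := by
  intro hlt
  rcases Nat.eq_zero_or_pos k with rfl | hk
  · exact not_design_levelZero hε hsep hlt
  · have hV2 := two_le_volume hε hlt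
    have hTPP := tpp_of_rankSep hsep
    have hVG : X.card * Y.card * Z.card ≤ Fintype.card (GLm p 1) :=
      Literature.Barriers.MatrixMultiplication.tripleProductProperty_card_le_of_comm glOne_comm hTPP
    rw [budget_matOne hk] at hlt
    have hV1 : (1 : ℝ) ≤ volume X Y Z := by
      unfold volume; exact_mod_cast (by omega : 1 ≤ X.card * Y.card * Z.card)
    have hpow : volume X Y Z ^ ((2 + ε) / 3) ≤ volume X Y Z := by
      conv_rhs => rw [← Real.rpow_one (volume X Y Z)]
      exact Real.rpow_le_rpow_of_exponent_le hV1 (by linarith)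
    have hVG' : volume X Y Z ≤ Fintype.card (GLm p 1) := by unfold volume; exact_mod_cast hVG
    linarith

end Abelian

/-- **STRENGTHENING REFUTED (`m = 1`).**  The abelian slice `m = 1` of `LieRankDesigns` is false
(already for `ε = 1`): `GL_1(𝔽_p) = 𝔽_p^×` cannot host a graded design. Any witness has `m ≥ 2`. -/
theorem not_lieRankDesigns_matOne :
    ¬ (∀ ε : ℝ, 0 < ε → ∃ (p : ℕ) (_ : Fact p.Prime) (k : ℕ) (X Y Z : Finset (GLm p 1)),
        RankSep k X Y Z ∧ budget p 1 k (2 + ε) < volume X Y Z ^ ((2 + ε) / 3)) := by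
  intro h
  obtain ⟨p, hp, k, X, Y, Z, hsep, hlt⟩ := h 1 one_pos
  exact not_design_matOne one_pos le_rfl hsep hlt

end Summit.MatrixMultiplication.MatrixMultiplication.Cruxes.LieRankDesigns.Disproof

end
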